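import Summits.QuantumFields.YangMills.Theorems.AlphaInputsT3ACv3EMLTwoFieldProp3
import HarnessLib

/-!
# `AlphaInputsT3ACv3EMLTwoFieldIterUniform` — STRATEGY B for 2′, non-abelian (FL) input (memo v2 row R3): **THE DERIVATIVE ROW — the `k`-FOLD (0.4) AVERAGE IS C^{1,1} ON THE NATURAL SCALES
# WITH A `k`-UNIFORM CONSTANT**: for two `SU(N)` fields on the finest lattice, `U₂` `δ`-close to `1` and `U₁` `ρ`-close to `U₂`,
# `‖(Ū₁^{(s)}(c) − Ū₂^{(s)}(c)) − (Q^{(s)}(U₁ − U₂))(c)‖ ≤ 5200·L·(d+2)²·m_s(ρ)·(m_s(ρ) + m_s(δ))` for all `s ≤ k` (`m_s(x) = 2|n|²(d+1)L^s x`), under ONE smallness on `m_k` and `d + 2 ≤ L`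
# — lane `pub-balaban3d` ∕ cell `ym3-torus`, seat `ym-ust-19936-w1` (g0)

WHY (HOME `ym-ust-19936-w1/NONABELIAN-FL-NEWTON-w1-g0.md` §2 R3, §3; OWNER RULING g24-№4 «the crux of the row is k-UNIFORMITY of the contraction constants»).  This is the statement the
contraction for `hLift` consumes: at ANY `δ`-small background the derivative of the `k`-fold average of record differs from the flat composite `Q^{(k)}` by `O(L·(d+2)²·(m_k(ρ)+m_k(δ)))` in
operator norm on the natural scales, uniformly in `k`.  PROOF = the two-field one-step Prop. 3 (`…v3EMLTwoFieldProp3.norm_rem_sub_rem_le`, constant `1300ℓ²`) iterated by the DEVICE of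
`…v3EMLIterFirstOrderUniform`: `g_{s+1} ≤ (d+1)L·g_s + 5200ℓ²·m_s(ρ)(m_s(ρ)+m_s(δ))`, sources `∝ L^{2s}`, amplification `(d+1)L < L²`.
WHAT IS HERE (no definition; `Q` any family with `Q 0 = id`, `Q (s+1) Y c = linAvg (Q s Y) c`): `step_dominates₂` (the closed form survives one step when `d + 2 ≤ L`), ★★
`norm_iter_sub_iter_sub_iterLin_le_uniform` (the title, with the companion size `‖Ū₁^{(s)}(c) − Ū₂^{(s)}(c)‖ ≤ 2m_s(ρ)`).
HONEST FRAMING.  Flat gauge (both fields near `1` bondwise — on a stencil in the regional axial gauge, memo v2 §1); count-neutral helper toward R3 2′ (items 19936∕19935); (FL)∕`hLift` NOT proved;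
registry untouched; nothing about d = 4, the continuum, or a mass gap; YM₃ on T³ is rung R3, not Clay.

References: T. Bałaban, Commun. Math. Phys. 98 (1985) 17–51 [Balaban1985Averaging] (Prop. 4 (134)–(135) p.38, Prop. 5 (156)–(157) p.42, Prop. 7 p.43); CMP 109 (1987) 249–301
[Balaban1987RG1] ((0.4), (0.11) p.253).
-/

set_option autoImplicit false

noncomputable section

namespace Summit.QuantumFields.YangMills.Theorems.EMLTwoField

open Finset
open scoped Matrix.Norms.L2Operator
open Literature.MathematicalPhysics.QuantumFieldTheory.Balaban1983to89
open T4Continuum AveragingRT BlockAveraging ExpMeanLog BlockAveragingEMLLinearised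
open Summit.QuantumFields.YangMills.Theorems.Prop7LinAvgOnto (linAvg_add)
open Summit.QuantumFields.YangMills.Theorems.Prop7AvgLinearisation (iter_zero_apply' iter_succ_eq_avgFun' linAvg_sub)
open Summit.QuantumFields.YangMills.Theorems.LinearAvgMatrix (norm_iterLin_le)
open Summit.QuantumFields.YangMills.Theorems.EMLIterUniform (norm_linAvg_le_sharp main_scale_mono norm_iter_sub_one_sub_iterLin_le_uniform)

variable {P : Params} {n : Type*} [Fintype n] [DecidableEq n] [Nonempty n]

/-- **GEOMETRIC DOMINATION FOR THE TWO-FIELD RECURSION**: with `C = 5200·L·(d+2)²` and `d + 2 ≤ L`, `(d+1)L·(C·X) + 5200ℓ²·X ≤ C·(L²·X)` for `X ≥ 0`. [cite: Balaban1985Averaging, (132)–(133) p.38] -/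
theorem step_dominates₂ (hL : P.d + 2 ≤ P.L) {X : ℝ} (hX : 0 ≤ X) :
    ((P.d : ℝ) + 1) * (P.L : ℝ) * (5200 * (P.L : ℝ) * ((P.d : ℝ) + 2) ^ 2 * X) + 5200 * (((P.d + 2) * P.L : ℕ) : ℝ) ^ 2 * X ≤
      5200 * (P.L : ℝ) * ((P.d : ℝ) + 2) ^ 2 * ((P.L : ℝ) ^ 2 * X) := by
  have hL' : (P.d : ℝ) + 2 ≤ (P.L : ℝ) := by exact_mod_cast hL
  have hL0 : (0 : ℝ) ≤ P.L := Nat.cast_nonneg _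
  have hkey : 0 ≤ 5200 * (P.L : ℝ) ^ 2 * ((P.d : ℝ) + 2) ^ 2 * X * ((P.L : ℝ) - ((P.d : ℝ) + 2)) := by
    have : (0 : ℝ) ≤ (P.L : ℝ) - ((P.d : ℝ) + 2) := by linarith
    positivity
  push_cast
  nlinarith [hkey]
set_option maxHeartbeats 400000 in
/-- **★★ THE DERIVATIVE ROW, `k`-UNIFORM.**  Let `Q` be any family with `Q 0 Y = Y`, `Q (s+1) Y c = linAvg (Q s Y) c`; `d + 2 ≤ L`; `U₁, U₂` `SU(N)` fields on the finest lattice with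
`‖U₂,b − 1‖ ≤ δ`, `‖U₁,b − U₂,b‖ ≤ ρ`; `m_s(x) := 2|n|²(d+1)L^s x`, `ℓ = (d+2)L`.  If `324L(d+2)²·m_k(δ) ≤ 1`, `5200L(d+2)²·(m_k(ρ) + m_k(δ)) ≤ 1` and `4ℓ(m_k(ρ) + m_k(δ)) < δ_N`, then for
every `s ≤ k` and every level-`s` bond `c`:  `‖Ū₁^{(s)}(c) − Ū₂^{(s)}(c)‖ ≤ 2m_s(ρ)` and
`‖(Ū₁^{(s)}(c) − Ū₂^{(s)}(c)) − (Q^{(s)}(U₁ − U₂))(c)‖ ≤ 5200·L·(d+2)²·m_s(ρ)·(m_s(ρ) + m_s(δ))`. [cite: Balaban1985Averaging, Prop. 4 (134)–(135) p.38, Prop. 5 (156)–(157) p.42] -/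
theorem norm_iter_sub_iter_sub_iterLin_le_uniform
    (Q : (i : ℕ) → (PBond P 0 → Matrix n n ℂ) → PBond P i → Matrix n n ℂ)
    (hQ0 : ∀ Y, Q 0 Y = Y) (hQs : ∀ (i : ℕ) (Y : PBond P 0 → Matrix n n ℂ) (c : PBond P (i + 1)), Q (i + 1) Y c = linAvg (Q i Y) c)
    (hL : P.d + 2 ≤ P.L) (U₁ U₂ : GaugeField P 0 (Matrix.specialUnitaryGroup n ℂ)) {δ ρ : ℝ} (hδ : 0 ≤ δ) (hρ0 : 0 ≤ ρ)
    (hU₂ : ∀ b, ‖((U₂ b : Matrix.specialUnitaryGroup n ℂ) : Matrix n n ℂ) - 1‖ ≤ δ)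
    (hρ : ∀ b, ‖((U₁ b : Matrix.specialUnitaryGroup n ℂ) : Matrix n n ℂ) - ((U₂ b : Matrix.specialUnitaryGroup n ℂ) : Matrix n n ℂ)‖ ≤ ρ) (k : ℕ)
    (hmδ : 324 * (P.L : ℝ) * ((P.d : ℝ) + 2) ^ 2 * (2 * (Fintype.card n : ℝ) ^ 2 * (((P.d : ℝ) + 1) * (P.L : ℝ) ^ k * δ)) ≤ 1)
    (hm : 5200 * (P.L : ℝ) * ((P.d : ℝ) + 2) ^ 2 *
      (2 * (Fintype.card n : ℝ) ^ 2 * (((P.d : ℝ) + 1) * (P.L : ℝ) ^ k * ρ) + 2 * (Fintype.card n : ℝ) ^ 2 * (((P.d : ℝ) + 1) * (P.L : ℝ) ^ k * δ)) ≤ 1)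
    (hN : 4 * (((P.d + 2) * P.L : ℕ) : ℝ) *
      (2 * (Fintype.card n : ℝ) ^ 2 * (((P.d : ℝ) + 1) * (P.L : ℝ) ^ k * ρ) + 2 * (Fintype.card n : ℝ) ^ 2 * (((P.d : ℝ) + 1) * (P.L : ℝ) ^ k * δ)) < deltaSU n) :
    ∀ s : ℕ, s ≤ k → ∀ c : PBond P s,
      ‖((Averaging.iter (fun i => blockAvg (P := P) (j := i) (expMeanLogSU (n := n))) s U₁ c : Matrix.specialUnitaryGroup n ℂ) : Matrix n n ℂ) -
          ((Averaging.iter (fun i => blockAvg (P := P) (j := i) (expMeanLogSU (n := n))) s U₂ c : Matrix.specialUnitaryGroup n ℂ) : Matrix n n ℂ)‖ ≤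
          2 * (2 * (Fintype.card n : ℝ) ^ 2 * (((P.d : ℝ) + 1) * (P.L : ℝ) ^ s * ρ)) ∧
      ‖((Averaging.iter (fun i => blockAvg (P := P) (j := i) (expMeanLogSU (n := n))) s U₁ c : Matrix.specialUnitaryGroup n ℂ) : Matrix n n ℂ) -
          ((Averaging.iter (fun i => blockAvg (P := P) (j := i) (expMeanLogSU (n := n))) s U₂ c : Matrix.specialUnitaryGroup n ℂ) : Matrix n n ℂ) -
          Q s (fun b => ((U₁ b : Matrix.specialUnitaryGroup n ℂ) : Matrix n n ℂ) - ((U₂ b : Matrix.specialUnitaryGroup n ℂ) : Matrix n n ℂ)) c‖ ≤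
        5200 * (P.L : ℝ) * ((P.d : ℝ) + 2) ^ 2 * ((2 * (Fintype.card n : ℝ) ^ 2 * (((P.d : ℝ) + 1) * (P.L : ℝ) ^ s * ρ)) *
          ((2 * (Fintype.card n : ℝ) ^ 2 * (((P.d : ℝ) + 1) * (P.L : ℝ) ^ s * ρ)) + (2 * (Fintype.card n : ℝ) ^ 2 * (((P.d : ℝ) + 1) * (P.L : ℝ) ^ s * δ)))) := by
  -- letters
  set ℓ : ℝ := (((P.d + 2) * P.L : ℕ) : ℝ) with hℓ
  set C : ℝ := 5200 * (P.L : ℝ) * ((P.d : ℝ) + 2) ^ 2 with hC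
  set Z : PBond P 0 → Matrix n n ℂ := fun b => ((U₁ b : Matrix.specialUnitaryGroup n ℂ) : Matrix n n ℂ) - ((U₂ b : Matrix.specialUnitaryGroup n ℂ) : Matrix n n ℂ) with hZ
  let mρ : ℕ → ℝ := fun s => 2 * (Fintype.card n : ℝ) ^ 2 * (((P.d : ℝ) + 1) * (P.L : ℝ) ^ s * ρ)
  let mδ : ℕ → ℝ := fun s => 2 * (Fintype.card n : ℝ) ^ 2 * (((P.d : ℝ) + 1) * (P.L : ℝ) ^ s * δ)
  have hmρ_def : ∀ s, mρ s = 2 * (Fintype.card n : ℝ) ^ 2 * (((P.d : ℝ) + 1) * (P.L : ℝ) ^ s * ρ) := fun s => rfl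
  have hmδ_def : ∀ s, mδ s = 2 * (Fintype.card n : ℝ) ^ 2 * (((P.d : ℝ) + 1) * (P.L : ℝ) ^ s * δ) := fun s => rfl
  have hL0 : (0 : ℝ) ≤ P.L := Nat.cast_nonneg _
  have hℓeq : ℓ = ((P.d : ℝ) + 2) * P.L := by rw [hℓ]; push_cast; ring
  have hℓ0 : 0 ≤ ℓ := by rw [hℓ]; exact Nat.cast_nonneg _
  have hd0 : (0 : ℝ) ≤ P.d := Nat.cast_nonneg _
  have hC0 : 0 ≤ C := by positivity
  have hmρ0 : ∀ s, 0 ≤ mρ s := fun s => by rw [hmρ_def]; positivity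
  have hmδ0 : ∀ s, 0 ≤ mδ s := fun s => by rw [hmδ_def]; positivity
  have hmρsucc : ∀ s, mρ (s + 1) = (P.L : ℝ) * mρ s := fun s => by rw [hmρ_def, hmρ_def, pow_succ]; ring
  have hmδsucc : ∀ s, mδ (s + 1) = (P.L : ℝ) * mδ s := fun s => by rw [hmδ_def, hmδ_def, pow_succ]; ring
  have hmonoρ : ∀ s, s ≤ k → mρ s ≤ mρ k := fun s hs => main_scale_mono (n := n) hρ0 hs
  have hmonoδ : ∀ s, s ≤ k → mδ s ≤ mδ k := fun s hs => main_scale_mono (n := n) hδ hs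
  have hZρ : ∀ b, ‖Z b‖ ≤ ρ := hρ
  -- the background `U₂` through the levels (flat Prop. 4, k-uniform)
  have hmδk' : 324 * (P.L : ℝ) * ((P.d : ℝ) + 2) ^ 2 * mδ k ≤ 1 := hmδ
  have hNδ : 4 * ℓ * mδ k < deltaSU n := by
    have : 4 * ℓ * mδ k ≤ 4 * ℓ * (mρ k + mδ k) := by nlinarith [hmρ0 k]
    exact this.trans_lt hN
  have hbg := norm_iter_sub_one_sub_iterLin_le_uniform Q hQ0 hQs hL U₂ hδ hU₂ k hmδk' hNδ
  -- the main term on its natural scale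
  have hmain : ∀ (s : ℕ) (c : PBond P s), ‖Q s Z c‖ ≤ mρ s := fun s c => norm_iterLin_le Q hQ0 hQs Z hZρ s c
  -- the induction
  have key : ∀ s : ℕ, s ≤ k → ∀ c : PBond P s,
      ‖((Averaging.iter (fun i => blockAvg (P := P) (j := i) (expMeanLogSU (n := n))) s U₁ c : Matrix.specialUnitaryGroup n ℂ) : Matrix n n ℂ) -
          ((Averaging.iter (fun i => blockAvg (P := P) (j := i) (expMeanLogSU (n := n))) s U₂ c : Matrix.specialUnitaryGroup n ℂ) : Matrix n n ℂ) - Q s Z c‖ ≤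
        C * (mρ s * (mρ s + mδ s)) := by
    intro s
    induction s with
    | zero =>
      intro _ c
      rw [iter_zero_apply', iter_zero_apply', hQ0, sub_self, norm_zero]
      exact mul_nonneg hC0 (mul_nonneg (hmρ0 0) (add_nonneg (hmρ0 0) (hmδ0 0)))
    | succ s ih =>
      intro hsk c
      have hs : s ≤ k := (Nat.le_succ s).trans hsk
      have ihs := ih hs
      -- sizes at level `s`
      have hCm : C * (mρ s + mδ s) ≤ 1 := (mul_le_mul_of_nonneg_left (add_le_add (hmonoρ s hs) (hmonoδ s hs)) hC0).trans hm
      have hGm : C * (mρ s * (mρ s + mδ s)) ≤ mρ s := by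
        have : C * (mρ s * (mρ s + mδ s)) = (C * (mρ s + mδ s)) * mρ s := by ring
        rw [this]; exact (mul_le_mul_of_nonneg_right hCm (hmρ0 s)).trans_eq (one_mul _)
      set W₁ : GaugeField P s (Matrix.specialUnitaryGroup n ℂ) := Averaging.iter (fun i => blockAvg (P := P) (j := i) (expMeanLogSU (n := n))) s U₁ with hW₁
      set W₂ : GaugeField P s (Matrix.specialUnitaryGroup n ℂ) := Averaging.iter (fun i => blockAvg (P := P) (j := i) (expMeanLogSU (n := n))) s U₂ with hW₂
      set G : PBond P s → Matrix n n ℂ := fun b => ((W₁ b : Matrix.specialUnitaryGroup n ℂ) : Matrix n n ℂ) - ((W₂ b : Matrix.specialUnitaryGroup n ℂ) : Matrix n n ℂ) - Q s Z b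
        with hG
      have hGb : ∀ b, ‖G b‖ ≤ C * (mρ s * (mρ s + mδ s)) := fun b => ihs b
      have hW₂1 : ∀ b, ‖((W₂ b : Matrix.specialUnitaryGroup n ℂ) : Matrix n n ℂ) - 1‖ ≤ 2 * mδ s := fun b => (hbg s hs b).1
      have hρs : ∀ b, ‖((W₁ b : Matrix.specialUnitaryGroup n ℂ) : Matrix n n ℂ) - ((W₂ b : Matrix.specialUnitaryGroup n ℂ) : Matrix n n ℂ)‖ ≤ 2 * mρ s := fun b => by
        have e : ((W₁ b : Matrix.specialUnitaryGroup n ℂ) : Matrix n n ℂ) - ((W₂ b : Matrix.specialUnitaryGroup n ℂ) : Matrix n n ℂ) = Q s Z b + G b := by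
          simp only [hG]; rw [add_sub_cancel]
        rw [e]
        exact (norm_add_le _ _).trans (by linarith [hmain s b, hGb b, hGm])
      -- the two-field one-step hypotheses at scales `2mδ s`, `2mρ s`
      have h2δ0 : 0 ≤ 2 * mδ s := by linarith [hmδ0 s]
      have h2ρ0 : 0 ≤ 2 * mρ s := by linarith [hmρ0 s]
      have hC_ge : 200 * ℓ ≤ C := by
        rw [hℓeq, hC]
        have : (0 : ℝ) ≤ (P.d : ℝ) + 2 := by positivity
        nlinarith [mul_nonneg this hL0]
      have h100 : 100 * (ℓ * (2 * mδ s)) ≤ 1 := by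
        have h1 : 100 * (ℓ * (2 * mδ s)) = (200 * ℓ) * mδ s := by ring
        rw [h1]
        refine le_trans (mul_le_mul_of_nonneg_right hC_ge (hmδ0 s)) (le_trans ?_ hCm)
        nlinarith [hmρ0 s, hC0]
      have h48 : 48 * (ℓ * (2 * mρ s)) ≤ 1 := by
        have h1 : 48 * (ℓ * (2 * mρ s)) ≤ (200 * ℓ) * mρ s := by nlinarith [hmρ0 s, hℓ0]
        refine h1.trans (le_trans (mul_le_mul_of_nonneg_right hC_ge (hmρ0 s)) (le_trans ?_ hCm))
        nlinarith [hmδ0 s, hC0]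
      have hNs : 2 * (ℓ * (2 * mρ s)) + 2 * (ℓ * (2 * mδ s)) < deltaSU n := by
        have : 2 * (ℓ * (2 * mρ s)) + 2 * (ℓ * (2 * mδ s)) ≤ 4 * ℓ * (mρ k + mδ k) := by nlinarith [hmonoρ s hs, hmonoδ s hs, hℓ0]
        exact this.trans_lt hN
      have htwo := norm_rem_sub_rem_le (n := n) W₁ W₂ h2δ0 h2ρ0 hW₂1 hρs h100 h48 hNs c
      -- `Q₁(W₁ − W₂) = Q^{(s+1)}Z + Q₁ G`
      have hsplit : linAvg (fun b => ((W₁ b : Matrix.specialUnitaryGroup n ℂ) : Matrix n n ℂ) - 1) c -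
          linAvg (fun b => ((W₂ b : Matrix.specialUnitaryGroup n ℂ) : Matrix n n ℂ) - 1) c = Q (s + 1) Z c + linAvg G c := by
        rw [← linAvg_sub]
        have e : (fun b => (((W₁ b : Matrix.specialUnitaryGroup n ℂ) : Matrix n n ℂ) - 1) - (((W₂ b : Matrix.specialUnitaryGroup n ℂ) : Matrix n n ℂ) - 1)) =
            fun b => Q s Z b + G b := by
          funext b; simp only [hG]; rw [sub_sub_sub_cancel_right, add_sub_cancel]
        rw [e, linAvg_add, hQs]
      have hlinG : ‖linAvg G c‖ ≤ ((P.d : ℝ) + 1) * (P.L : ℝ) * (C * (mρ s * (mρ s + mδ s))) :=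
        norm_linAvg_le_sharp G (by positivity) hGb c
      rw [iter_succ_eq_avgFun', iter_succ_eq_avgFun']
      set A₁ : Matrix n n ℂ := ((avgFun (expMeanLogSU (n := n)) W₁ c : Matrix.specialUnitaryGroup n ℂ) : Matrix n n ℂ)
      set A₂ : Matrix n n ℂ := ((avgFun (expMeanLogSU (n := n)) W₂ c : Matrix.specialUnitaryGroup n ℂ) : Matrix n n ℂ)
      have e2 : A₁ - A₂ - Q (s + 1) Z c =
          ((A₁ - 1 - linAvg (fun b => ((W₁ b : Matrix.specialUnitaryGroup n ℂ) : Matrix n n ℂ) - 1) c) -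
            (A₂ - 1 - linAvg (fun b => ((W₂ b : Matrix.specialUnitaryGroup n ℂ) : Matrix n n ℂ) - 1) c)) + linAvg G c := by
        have e3 : Q (s + 1) Z c = (linAvg (fun b => ((W₁ b : Matrix.specialUnitaryGroup n ℂ) : Matrix n n ℂ) - 1) c -
            linAvg (fun b => ((W₂ b : Matrix.specialUnitaryGroup n ℂ) : Matrix n n ℂ) - 1) c) - linAvg G c := by rw [hsplit]; abel
        rw [e3]; abel
      rw [e2]
      calc _ ≤ 1300 * ℓ ^ 2 * (2 * mρ s) * (2 * mρ s + 2 * mδ s) + ((P.d : ℝ) + 1) * (P.L : ℝ) * (C * (mρ s * (mρ s + mδ s))) :=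
            (norm_add_le _ _).trans (add_le_add htwo hlinG)
        _ = ((P.d : ℝ) + 1) * (P.L : ℝ) * (5200 * (P.L : ℝ) * ((P.d : ℝ) + 2) ^ 2 * (mρ s * (mρ s + mδ s))) + 5200 * ℓ ^ 2 * (mρ s * (mρ s + mδ s)) := by
            rw [hC]; ring
        _ ≤ 5200 * (P.L : ℝ) * ((P.d : ℝ) + 2) ^ 2 * ((P.L : ℝ) ^ 2 * (mρ s * (mρ s + mδ s))) :=
            step_dominates₂ hL (mul_nonneg (hmρ0 s) (add_nonneg (hmρ0 s) (hmδ0 s)))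
        _ = C * (mρ (s + 1) * (mρ (s + 1) + mδ (s + 1))) := by rw [hmρsucc, hmδsucc, hC]; ring
  -- assemble
  intro s hs c
  have h2 := key s hs c
  refine ⟨?_, h2⟩
  have hCm : C * (mρ s + mδ s) ≤ 1 := (mul_le_mul_of_nonneg_left (add_le_add (hmonoρ s hs) (hmonoδ s hs)) hC0).trans hm
  have hGm : C * (mρ s * (mρ s + mδ s)) ≤ mρ s := by
    have : C * (mρ s * (mρ s + mδ s)) = (C * (mρ s + mδ s)) * mρ s := by ring
    rw [this]; exact (mul_le_mul_of_nonneg_right hCm (hmρ0 s)).trans_eq (one_mul _)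
  have e : ((Averaging.iter (fun i => blockAvg (P := P) (j := i) (expMeanLogSU (n := n))) s U₁ c : Matrix.specialUnitaryGroup n ℂ) : Matrix n n ℂ) -
        ((Averaging.iter (fun i => blockAvg (P := P) (j := i) (expMeanLogSU (n := n))) s U₂ c : Matrix.specialUnitaryGroup n ℂ) : Matrix n n ℂ) =
      Q s Z c + (((Averaging.iter (fun i => blockAvg (P := P) (j := i) (expMeanLogSU (n := n))) s U₁ c : Matrix.specialUnitaryGroup n ℂ) : Matrix n n ℂ) -
        ((Averaging.iter (fun i => blockAvg (P := P) (j := i) (expMeanLogSU (n := n))) s U₂ c : Matrix.specialUnitaryGroup n ℂ) : Matrix n n ℂ) - Q s Z c) := by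
    abel
  rw [e]
  exact (norm_add_le _ _).trans (by linarith [hmain s c])

end Summit.QuantumFields.YangMills.Theorems.EMLTwoField

end
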